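import Summits.Ventures.PercRepro.PuncturedLYM

/-!
# PercRepro — (SP) FOR THE FAMILIES WITH AT LEAST THE AVERAGE NUMBER OF CODE NEIGHBOURS (p10, gen 30; continues
PuncturedLYM)

The regular weights (`1/j` on touched, `1/(j+1)` on untouched pairs) have column sums exactly `1` for EVERY code, and the
row sum at `X ∈ P` is `ρ(X) = t(X)/j + (n − j − t(X))/(j+1)` (`sum_sups_regWeight`), whose total over `P` is `#Y`
(`sum_rowSum_eq_card`).  Hence, for every code and every family `𝒜 ⊆ P`:

* `card_upNbhd_ge_sum_rowSum` — `Σ_{X ∈ 𝒜} ρ(X) ≤ #N(𝒜)` (the weighted double count of the master lemma, with a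
  family-dependent left side);
* `puncturedNMP_of_avg_touched` — **the Hall inequality `#𝒜 · #Y ≤ #N(𝒜) · #P` holds for every family whose touched
  count is at least the average: `#P · Σ_{X ∈ 𝒜} t(X) ≥ #𝒜 · Σ_{X ∈ P} t(X)`** (`Σ_X ρ(X) = #𝒜 (n−j)/(j+1) +
  T(𝒜)/(j(j+1))`, so `Σ_{𝒜} ρ ≥ #𝒜 · #Y / #P` exactly when `avg_𝒜 t ≥ avg_P t`).
This is exactly the regime of (SP) reachable by the elementary double count (paper §4(a)); the FAR families (`t = 0`)
are the ones it misses, and the potential coupling of PuncturedLYMPotential is the proposed route for them.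
Nothing here asserts (SP).
-/

namespace PercRepro.PuncturedLYM

open Finset

variable {α : Type} [Fintype α] [DecidableEq α]

/-- The regular row sum `ρ(X) = t(X)/j + (n − j − t(X))/(j+1)`. -/
def rowSum (α : Type) [Fintype α] [DecidableEq α] (j : ℕ) (D : Finset (Finset α)) (X : Finset α) : ℚ :=
  (touchedCount D X : ℚ) / j + ((Fintype.card α - j - touchedCount D X : ℕ) : ℚ) / (j + 1)

/-- `Σ_{X ∈ 𝒜} ρ(X) ≤ #N(𝒜)` for every family `𝒜 ⊆ P` (weighted double count with the regular weights). -/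
theorem card_upNbhd_ge_sum_rowSum {j : ℕ} {D : Finset (Finset α)} (hD : IsCode j D) (hj : 0 < j)
    {𝒜 : Finset (Finset α)} (h𝒜 : 𝒜 ⊆ punctured j D) :
    ∑ X ∈ 𝒜, rowSum α j D X ≤ (upNbhd j 𝒜).card := by
  have h1 : ∑ X ∈ 𝒜, rowSum α j D X = ∑ X ∈ 𝒜, ∑ Y ∈ sups j X, regWeight j D X Y := by
    apply sum_congr rfl
    intro X hX
    rw [sum_sups_regWeight (mem_punctured.1 (h𝒜 hX)).1]
    rfl
  have h2 : ∑ X ∈ 𝒜, ∑ Y ∈ sups j X, regWeight j D X Y =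
      ∑ Y ∈ upNbhd j 𝒜, ∑ X ∈ 𝒜.filter (fun X => X ⊆ Y), regWeight j D X Y := by
    apply sum_comm'
    intro X Y
    simp only [mem_sups, mem_upNbhd, mem_filter]
    constructor
    · rintro ⟨hX, hY, hXY⟩
      exact ⟨⟨hX, hXY⟩, hY, X, hX, hXY⟩
    · rintro ⟨⟨hX, hXY⟩, hY, -⟩
      exact ⟨hX, hY, hXY⟩
  have h3 : ∑ Y ∈ upNbhd j 𝒜, ∑ X ∈ 𝒜.filter (fun X => X ⊆ Y), regWeight j D X Y ≤
      ∑ Y ∈ upNbhd j 𝒜, (1 : ℚ) := by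
    apply sum_le_sum
    intro Y hY
    have hY' : Y ∈ levelAbove α j := (mem_filter.1 hY).1
    calc ∑ X ∈ 𝒜.filter (fun X => X ⊆ Y), regWeight j D X Y ≤ ∑ X ∈ subsP j D Y, regWeight j D X Y := by
          apply sum_le_sum_of_subset_of_nonneg
          · intro X hX
            rw [mem_filter] at hX
            exact mem_filter.2 ⟨h𝒜 hX.1, hX.2⟩
          · intro X _ _
            exact regWeight_nonneg j D X Y
      _ = 1 := sum_subsP_regWeight hD hj (mem_levelAbove.1 hY')
  calc ∑ X ∈ 𝒜, rowSum α j D X = ∑ X ∈ 𝒜, ∑ Y ∈ sups j X, regWeight j D X Y := h1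
    _ = ∑ Y ∈ upNbhd j 𝒜, ∑ X ∈ 𝒜.filter (fun X => X ⊆ Y), regWeight j D X Y := h2
    _ ≤ ∑ Y ∈ upNbhd j 𝒜, (1 : ℚ) := h3
    _ = (upNbhd j 𝒜).card := by simp

/-- The total of the regular row sums over `P` is `#Y`. -/
theorem sum_rowSum_eq_card {j : ℕ} {D : Finset (Finset α)} (hD : IsCode j D) (hj : 0 < j) :
    ∑ X ∈ punctured j D, rowSum α j D X = (levelAbove α j).card := by
  calc ∑ X ∈ punctured j D, rowSum α j D X = ∑ X ∈ punctured j D, ∑ Y ∈ sups j X, regWeight j D X Y := by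
        apply sum_congr rfl
        intro X hX
        rw [sum_sups_regWeight (mem_punctured.1 hX).1]
        rfl
    _ = ∑ Y ∈ levelAbove α j, ∑ X ∈ subsP j D Y, regWeight j D X Y := by
        apply sum_comm'
        intro X Y
        simp only [mem_sups, mem_subsP, mem_punctured, mem_levelAbove]
        tauto
    _ = ∑ Y ∈ levelAbove α j, (1 : ℚ) :=
        sum_congr rfl (fun Y hY => sum_subsP_regWeight hD hj (mem_levelAbove.1 hY))
    _ = (levelAbove α j).card := by simp

/-- `ρ(X) = (n − j)/(j+1) + t(X)/(j(j+1))` for a `j`-set `X` (`j < n`). -/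
theorem rowSum_eq {j : ℕ} {D : Finset (Finset α)} (hj : 0 < j) {X : Finset α} (hX : X.card = j)
    (hjn : j < Fintype.card α) :
    rowSum α j D X = ((Fintype.card α : ℚ) - j) / (j + 1) + (touchedCount D X : ℚ) / (j * (j + 1)) := by
  unfold rowSum
  have ht : touchedCount D X ≤ Fintype.card α - j := touchedCount_le hX
  rw [Nat.cast_sub ht, Nat.cast_sub hjn.le]
  have hj' : (j : ℚ) ≠ 0 := by exact_mod_cast hj.ne'
  field_simp
  ring

/-- **(SP) for the families with at least the average touched count**: if `#P · Σ_{X ∈ 𝒜} t(X) ≥ #𝒜 · Σ_{X ∈ P} t(X)`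
then `#𝒜 · #Y ≤ #N(𝒜) · #P`. -/
theorem puncturedNMP_of_avg_touched {j : ℕ} {D : Finset (Finset α)} (hD : IsCode j D) (hj : 0 < j)
    (hjn : j < Fintype.card α) {𝒜 : Finset (Finset α)} (h𝒜 : 𝒜 ⊆ punctured j D)
    (havg : 𝒜.card * ∑ X ∈ punctured j D, touchedCount D X ≤
      (punctured j D).card * ∑ X ∈ 𝒜, touchedCount D X) :
    𝒜.card * (levelAbove α j).card ≤ (upNbhd j 𝒜).card * (punctured j D).card := by
  rcases Nat.eq_zero_or_pos (punctured j D).card with hP | hP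
  · have : 𝒜 = ∅ := subset_empty.1 (card_eq_zero.1 hP ▸ h𝒜)
    subst this
    simp
  -- `Σ_𝒜 ρ = #𝒜 (n−j)/(j+1) + T(𝒜)/(j(j+1))`, `Σ_P ρ = #Y`
  have hρ : ∀ X ∈ punctured j D, rowSum α j D X =
      ((Fintype.card α : ℚ) - j) / (j + 1) + (touchedCount D X : ℚ) / (j * (j + 1)) :=
    fun X hX => rowSum_eq hj (mem_punctured.1 hX).1 hjn
  set c : ℚ := ((Fintype.card α : ℚ) - j) / (j + 1)
  set e : ℚ := 1 / ((j : ℚ) * (j + 1))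
  have hsum : ∀ S ⊆ punctured j D, ∑ X ∈ S, rowSum α j D X = S.card * c + e * ∑ X ∈ S, (touchedCount D X : ℚ) := by
    intro S hS
    rw [sum_congr rfl (fun X hX => hρ X (hS hX)), sum_add_distrib, sum_const, nsmul_eq_mul, mul_sum]
    congr 1
    apply sum_congr rfl
    intro X _
    simp only [e]
    ring
  have hA := hsum 𝒜 h𝒜
  have hPs := hsum (punctured j D) (Subset.refl _)
  rw [sum_rowSum_eq_card hD hj] at hPs
  have hmain := card_upNbhd_ge_sum_rowSum hD hj h𝒜
  have he : 0 ≤ e := by positivity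
  have havg' : (𝒜.card : ℚ) * ∑ X ∈ punctured j D, (touchedCount D X : ℚ) ≤
      (punctured j D).card * ∑ X ∈ 𝒜, (touchedCount D X : ℚ) := by exact_mod_cast havg
  -- `#𝒜 · #Y = #𝒜 (#P c + e T(P)) ≤ #P (#𝒜 c + e T(𝒜)) = #P Σ_𝒜 ρ ≤ #P #N(𝒜)`
  have hq : ((𝒜.card * (levelAbove α j).card : ℕ) : ℚ) ≤ ((upNbhd j 𝒜).card * (punctured j D).card : ℕ) := by
    push_cast
    have hPq : (0 : ℚ) ≤ (punctured j D).card := by positivity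
    calc (𝒜.card : ℚ) * (levelAbove α j).card
        = 𝒜.card * ((punctured j D).card * c + e * ∑ X ∈ punctured j D, (touchedCount D X : ℚ)) := by rw [← hPs]
      _ ≤ (punctured j D).card * (𝒜.card * c + e * ∑ X ∈ 𝒜, (touchedCount D X : ℚ)) := by
          nlinarith [mul_le_mul_of_nonneg_left havg' he]
      _ = (punctured j D).card * ∑ X ∈ 𝒜, rowSum α j D X := by rw [hA]
      _ ≤ (punctured j D).card * (upNbhd j 𝒜).card := mul_le_mul_of_nonneg_left hmain hPq
      _ = (upNbhd j 𝒜).card * (punctured j D).card := by ring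
  exact_mod_cast hq

end PercRepro.PuncturedLYM
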